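import Literature.Claims.NS.ClayTorusBridge
import Literature.Claims.NS.ClayPeriodicSupBlowupCertificate
import Literature.Analysis.FluidPDE.TorusClassicalNSGalileanBoost
import Literature.Analysis.FunctionSpaces.TorusHolderBridge
import HarnessLib

/-!
# Clay (B)/(D) reference — the blow-up alternative for periodic data: printed-(10) solvability of one
# periodic Cauchy problem FAILS iff its classical solution blows up (enstrophy / gradient sup) in
# finite time; (B) ⇔ an a priori gradient bound for periodic classical solutions

Periodic twin of `ClayR3BlowupAlternative.lean`. On `𝕋³` the tree has the maximal classical solution
with the enstrophy blow-up alternative for smooth divergence-free data of any mean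
(`Literature.Analysis.FluidPDE.Torus.exists_maximal_classicalNS_anyMean`, Robinson–Rodrigo–Sadowski
2016 §6.3 + §8.1, landed by ns-claims-salvage-p3); this file transports it to Fefferman's periodic
setting on `ℝ³` (data (8), solutions with `u(·,t)`, `p(·,t)` `ℤ³`-periodic) through the Δ1 torus
bridges of `ClayTorusBridge.lean` / `ClayHorizonBridge.lean` and combines it with the pointwise sup-norm
certificates of `ClayPeriodicSupBlowupCertificate.lean`:

* (private helper `torus_gradNormSq_le_of_norm_fderiv_lift_le`) enstrophy is controlled by the gradient
  sup of the lift: `∫_{𝕋³} Σᵢ ‖∂ᵢg‖² ≤ 3 D²` if `‖∇(lift g)‖ ≤ D` on `ℝ³`;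
* `clayPeriodic_solvable_or_gradientSupBlowup` — for `ν > 0` and a smooth divergence-free
  `ℤ³`-periodic datum: EITHER `(ν, 0, u₀)` is solvable in the printed class (10), OR there are
  `0 < T* < ∞` and a classical solution `(u, p)` on `[0, T*) × ℝ³` from `u₀`, `u(·,t)` and `p(·,t)`
  periodic, whose velocity GRADIENT is unbounded on `[0, T*) × ℝ³` and whose enstrophy per period cell
  is unbounded on `[0, T*)`, such that every `u`,`p`-periodic classical solution from `u₀` on a closed
  slab `[0, b]` has `b < T*` and coincides with `u` on `[0, b]`;
* `not_clayPeriodic_solvable_iff_exists_gradientSupBlowup` — printed-(10) solvability of `(ν, 0, u₀)`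
  FAILS ⇔ some `u`,`p`-periodic classical solution from `u₀` on a half-open slab has unbounded
  gradient ((⇐) is `not_clayPeriodic_solvable_of_gradientSupCertificate`);
* `clayPeriodic_regularityAt_iff_aprioriGradientBound` / `clayPeriodic_regularity_iff_aprioriGradientBound(_at)`
  — **(B) ⇔ the qualitative a priori bound**: every `u`,`p`-periodic classical solution of the
  unforced system on a half-open slab `[0, T) × ℝ³` from a smooth divergence-free periodic datum has
  BOUNDED velocity gradient there (one viscosity ⇔ all, `clayPeriodic_regularityAt_iff`);
* `navierStokesBreakdownPeriodic_of_exists_gradientSupBlowup`, `exists_gradientSupBlowup_of_not_clayPeriodic_regularity`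
  — if (B) fails it fails through such a blow-up, and such a blow-up proves printed (D);
* (rev 2) `bddAbove_enstrophy_of_clayPeriodic_solvable`, `not_clayPeriodic_solvable_of_enstrophyBlowupCertificate`,
  `navierStokesBreakdownPeriodic_of_enstrophyBlowupCertificate`, `not_clayPeriodic_solvable_iff_exists_enstrophyBlowup`,
  `clayPeriodic_regularityAt_iff_aprioriEnstrophyBound` / `clayPeriodic_regularity_iff_aprioriEnstrophyBound(_at)`,
  `exists_enstrophyBlowup_of_not_clayPeriodic_regularity` — the same statements with the ENSTROPHY per
  period cell (`Torus.gradNormSq` of the descended slices, `= ∫_{𝕋³} Σᵢ ‖∂ᵢu‖²`) in place of the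
  gradient sup norm: **(B) ⇔ every `u`,`p`-periodic classical solution on a half-open slab from a smooth
  divergence-free periodic datum has enstrophy bounded above on `[0, T)`**; an enstrophy blow-up
  certificate proves (D).

Usage on a CARD (§3, periodic rows): a REG claim printed as «the velocity gradient (or the enstrophy)
of every smooth periodic solution stays bounded on its interval of existence» IS (B) by
`clayPeriodic_regularity_iff_aprioriGradientBound` / `…_iff_aprioriEnstrophyBound` — no Δ6 «local existence + continuation» delta;
deltas that remain: pressure not periodic (normalise first, Δ5,
`IsClassicalNSSolutionOn.exists_pressurePeriodic_of_velocityPeriodic_Ico_zero`), period `L ≠ 1`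
(Δ1, `ClayPeriodScalingBridge`), bounds on `|u|` only (Serrin `L^∞` step, not in this file), forcing (Δ3).

## References

* C. L. Fefferman, *Existence and smoothness of the Navier–Stokes equation*, CMI 2006, (B), (D) with
  (8)–(11) p. 2. [FeffermanClay2006]
* J. C. Robinson, J. L. Rodrigo, W. Sadowski, *The Three-Dimensional Navier–Stokes Equations*, CUP
  2016, §6.3 (Thm. 6.8, Lemma 6.11), §8.1, Cor. 8.4. [RobinsonRodrigoSadowskiCUP2016]
* T. Tao, Anal. PDE 6 (2013): Prop. 1.7, Lemma 4.1 (ii), §2. [Tao2013Localisation]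

WHAT THIS IS NOT: not a claim about NS regularity or blow-up; not a claim about any author beyond
the typed locator.
-/

open scoped ContDiff ENNReal Topology

namespace Literature.Claims.NS.ClayVariants

open Set Filter MeasureTheory Function Literature.Analysis Literature.Analysis.FluidPDE
  Literature.Analysis.FunctionSpaces

noncomputable section

/-! ## Enstrophy on `𝕋³` versus the gradient sup of the lift -/

/-- **Enstrophy is controlled by the gradient sup of the lift**: for a smooth `g : 𝕋³ → ℝ³` with
`‖∇(lift g)(y)‖ ≤ D` on `ℝ³`, `Torus.gradNormSq g = ∫_{𝕋³} Σᵢ ‖∂ᵢ g‖² ≤ 3 D²` (each `∂ᵢg(x)` is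
`∇(lift g)(repr x) eᵢ`, `Torus.lift_partialDeriv_eq`, and `𝕋³` has volume one). Private helper. [folklore] -/
private theorem torus_gradNormSq_le_of_norm_fderiv_lift_le
    {g : UnitAddTorus (Fin 3) → EuclideanSpace ℝ (Fin 3)} (hg : Torus.IsSmooth g) {D : ℝ}
    (hD : ∀ y : EuclideanSpace ℝ (Fin 3), ‖fderiv ℝ (Torus.lift g) y‖ ≤ D) :
    Torus.gradNormSq g ≤ 3 * D ^ 2 := by
  have hg1 : Torus.IsContDiff 1 g := hg.isContDiff (n := 1) (by exact_mod_cast le_top)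
  have hpt : ∀ (x : UnitAddTorus (Fin 3)) (i : Fin 3), ‖Torus.partialDeriv i g x‖ ≤ D := by
    intro x i
    have h1 : Torus.partialDeriv i g x =
        fderiv ℝ (Torus.lift g) (Torus.repr x) (EuclideanSpace.single i 1) := by
      have h := congrFun (Torus.lift_partialDeriv_eq hg1 i) (Torus.repr x)
      rwa [Torus.lift_apply, Torus.proj_repr] at h
    rw [h1]
    refine (ContinuousLinearMap.le_opNorm _ _).trans ?_
    have hn : ‖(EuclideanSpace.single i (1 : ℝ) : EuclideanSpace ℝ (Fin 3))‖ = 1 := by simp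
    rw [hn, mul_one]
    exact hD _
  calc Torus.gradNormSq g = ∫ x, ∑ i, ‖Torus.partialDeriv i g x‖ ^ 2 := rfl
    _ ≤ ∫ _x : UnitAddTorus (Fin 3), (3 * D ^ 2 : ℝ) := by
        refine integral_mono_of_nonneg (ae_of_all _ fun x => ?_) (integrable_const _)
          (ae_of_all _ fun x => ?_)
        · exact Finset.sum_nonneg fun i _ => sq_nonneg _
        · calc ∑ i, ‖Torus.partialDeriv i g x‖ ^ 2 ≤ ∑ _i : Fin 3, D ^ 2 :=
                Finset.sum_le_sum fun i _ => pow_le_pow_left₀ (norm_nonneg _) (hpt x i) 2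
            _ = 3 * D ^ 2 := by simp
    _ = 3 * D ^ 2 := by simp

/-! ## The alternative for one periodic Cauchy problem -/

variable {ν : ℝ} {u₀ : EuclideanSpace ℝ (Fin 3) → EuclideanSpace ℝ (Fin 3)}

/-- **The blow-up alternative for one periodic Clay Cauchy problem.** Let `ν > 0` and `u₀` smooth,
divergence free, `ℤ³`-periodic. EITHER `(ν, 0, u₀)` is solvable in the printed class (10) (`u`, `p`
smooth on `ℝ³ × [0,∞)`, `u(·,t)` periodic), OR there are `T* > 0` and a classical solution `(u, p)` of
the unforced system on `[0, T*) × ℝ³` with `u 0 = u₀`, `u(·,t)` and `p(·,t)` periodic for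
`t ∈ [0, T*)`, whose velocity gradient is UNBOUNDED on `[0, T*) × ℝ³` and whose enstrophy per period
cell is unbounded on `[0, T*)`, and such that every classical solution `(v, q)` from `u₀` on a closed
slab `[0, b]` with `v(·,t)`, `q(·,t)` periodic has `b < T*` and `v = u` on `[0, b]` (the tree's maximal
torus solution `Torus.exists_maximal_classicalNS_anyMean`, lifted).
[cite: FeffermanClay2006, (B) with (8) (10) (11) p. 2] [cite: RobinsonRodrigoSadowskiCUP2016, §6.3 p. 108 and §8.1 p. 122] -/
theorem clayPeriodic_solvable_or_gradientSupBlowup (hν : 0 < ν) (hu₀ : ContDiff ℝ ∞ u₀)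
    (hdiv : NSWave0.IsDivFree u₀) (hper : IsLatticePeriodic u₀) :
    clayPeriodic.Solvable ν 0 u₀ ∨
      ∃ Ts : ℝ, 0 < Ts ∧
        ∃ (u : ℝ → EuclideanSpace ℝ (Fin 3) → EuclideanSpace ℝ (Fin 3))
          (p : ℝ → EuclideanSpace ℝ (Fin 3) → ℝ),
          FluidPDE.IsClassicalNSSolutionOn (Ico 0 Ts) ν 0 u p ∧ u 0 = u₀ ∧
          (∀ t ∈ Ico 0 Ts, IsLatticePeriodic (u t) ∧ IsLatticePeriodic (p t)) ∧
          (∀ M : ℝ, ∃ t ∈ Ico 0 Ts, ∃ x : EuclideanSpace ℝ (Fin 3), M < ‖fderiv ℝ (u t) x‖) ∧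
          ¬ BddAbove ((fun t => Torus.gradNormSq (fun x => u t (Torus.repr x))) '' Ico 0 Ts) ∧
          ∀ (b : ℝ) (v : ℝ → EuclideanSpace ℝ (Fin 3) → EuclideanSpace ℝ (Fin 3))
            (q : ℝ → EuclideanSpace ℝ (Fin 3) → ℝ),
            FluidPDE.IsClassicalNSSolutionOn (Icc 0 b) ν 0 v q → v 0 = u₀ →
            (∀ t ∈ Icc 0 b, IsLatticePeriodic (v t) ∧ IsLatticePeriodic (q t)) →
              b < Ts ∧ ∀ s ∈ Icc 0 b, v s = u s := by
  -- the torus datum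
  set U₀ : UnitAddTorus (Fin 3) → EuclideanSpace ℝ (Fin 3) := fun x => u₀ (Torus.repr x) with hU₀
  have hlift₀ : Torus.lift U₀ = u₀ := Torus.lift_descend_holds u₀ hper
  have hU₀s : Torus.IsSmooth U₀ := (contDiff_lift_iff_isSmooth U₀).1 (hlift₀ ▸ hu₀)
  have hU₀d : Torus.IsDivFree U₀ := (isDivFree_lift_iff_torus hU₀s).1 (hlift₀ ▸ hdiv)
  obtain ⟨U, P, hU0, hcases⟩ :=
    Torus.exists_maximal_classicalNS_anyMean (d := Fin 3) (by simp) hν hU₀s hU₀d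
  rcases hcases with ⟨hglob, -⟩ | ⟨T, hT, hcl, hens, hmax⟩
  · -- global torus solution: lift it
    exact Or.inl ((clayPeriodic_solvable_zero_iff_torus ν hper).2 ⟨U, P, hglob, by rw [hU0, hlift₀]⟩)
  · right
    obtain ⟨hclR, hperR⟩ := periodic_lift_of_torus hcl
    have hdesc : ∀ t, (fun x => Torus.lift (U t) (Torus.repr x)) = U t := fun t => by
      funext x; rw [Torus.lift_apply, Torus.proj_repr]
    refine ⟨T, hT, fun t => Torus.lift (U t), fun t => Torus.lift (P t), hclR,
      by simp only [hU0, hlift₀], fun t _ => hperR t, ?_, ?_, ?_⟩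
    · -- gradient sup unbounded: a bound `D` would bound the enstrophy by `3 D²`
      intro M
      by_contra hbd
      push Not at hbd
      refine hens ⟨3 * M ^ 2, ?_⟩
      rintro _ ⟨t, ht, rfl⟩
      exact torus_gradNormSq_le_of_norm_fderiv_lift_le (hcl.smooth_velocity.isSmooth_slice ht)
        fun y => hbd t ht y
    · -- enstrophy unbounded (transport along `lift ∘ repr = id`)
      simpa only [hdesc] using hens
    · -- maximality among `u`,`p`-periodic classical solutions on closed slabs
      intro b v q hv hv0 hvper
      obtain ⟨hV, hVlift⟩ := torus_descend_of_periodic hv hvper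
      have hV0 : (fun x => v 0 (Torus.repr x)) = U₀ := by
        funext x; simp only [hU₀, hv0]
      obtain ⟨hb, heq⟩ := hmax b _ _ hV hV0
      refine ⟨hb, fun s hs => ?_⟩
      rw [← hVlift s hs, heq s hs]

/-- **Printed-(10) solvability of one periodic Cauchy problem fails iff its classical solution blows up
in gradient sup norm in finite time**: for `ν > 0` and `u₀` smooth divergence free `ℤ³`-periodic,
`¬ clayPeriodic.Solvable ν 0 u₀ ↔ ∃ T > 0, ∃ (u, p)` classical on `[0, T) × ℝ³`, `u 0 = u₀`, `u(·,t)`,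
`p(·,t)` periodic, `‖∇u‖` unbounded on `[0, T) × ℝ³` ((⇐) is
`not_clayPeriodic_solvable_of_gradientSupCertificate`, Majda–Bertozzi Cor. 3.1 uniqueness on `𝕋³`).
[cite: FeffermanClay2006, (B) (D) with (8) (10) (11) p. 2] [cite: RobinsonRodrigoSadowskiCUP2016, §6.3, §8.1] -/
theorem not_clayPeriodic_solvable_iff_exists_gradientSupBlowup (hν : 0 < ν) (hu₀ : ContDiff ℝ ∞ u₀)
    (hdiv : NSWave0.IsDivFree u₀) (hper : IsLatticePeriodic u₀) :
    ¬ clayPeriodic.Solvable ν 0 u₀ ↔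
      ∃ T : ℝ, 0 < T ∧
        ∃ (u : ℝ → EuclideanSpace ℝ (Fin 3) → EuclideanSpace ℝ (Fin 3))
          (p : ℝ → EuclideanSpace ℝ (Fin 3) → ℝ),
          FluidPDE.IsClassicalNSSolutionOn (Ico 0 T) ν 0 u p ∧ u 0 = u₀ ∧
          (∀ t ∈ Ico 0 T, IsLatticePeriodic (u t) ∧ IsLatticePeriodic (p t)) ∧
          ∀ M : ℝ, ∃ t ∈ Ico 0 T, ∃ x : EuclideanSpace ℝ (Fin 3), M < ‖fderiv ℝ (u t) x‖ := by
  constructor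
  · intro hno
    rcases clayPeriodic_solvable_or_gradientSupBlowup hν hu₀ hdiv hper with
      hsol | ⟨T, hT, u, p, hcl, hu0, hperT, hb, -, -⟩
    · exact absurd hsol hno
    · exact ⟨T, hT, u, p, hcl, hu0, hperT, hb⟩
  · rintro ⟨T, -, u, p, hcl, hu0, hperT, hb⟩
    exact not_clayPeriodic_solvable_of_gradientSupCertificate hν.le hcl hu0 hperT hb

/-- **(B) at one viscosity ⇔ the a priori gradient bound.** For `μ > 0`:
`clayPeriodic.RegularityAt μ` ⇔ every classical solution of the unforced system on a half-open slab
`[0, T) × ℝ³` from a smooth divergence-free `ℤ³`-periodic datum, with `u(·,t)` and `p(·,t)` periodic,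
has BOUNDED velocity gradient on `[0, T) × ℝ³` ((⇒) `exists_bounds_of_clayPeriodic_solvable`;
(⇐) `clayPeriodic_solvable_or_gradientSupBlowup`).
[cite: FeffermanClay2006, (B) with (8) (10) (11) p. 2] [cite: RobinsonRodrigoSadowskiCUP2016, §6.3, §8.1, Cor. 8.4] -/
theorem clayPeriodic_regularityAt_iff_aprioriGradientBound {μ : ℝ} (hμ : 0 < μ) :
    clayPeriodic.RegularityAt μ ↔
      ∀ (u₀ : EuclideanSpace ℝ (Fin 3) → EuclideanSpace ℝ (Fin 3)), ContDiff ℝ ∞ u₀ →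
        NSWave0.IsDivFree u₀ → IsLatticePeriodic u₀ →
        ∀ (T : ℝ) (u : ℝ → EuclideanSpace ℝ (Fin 3) → EuclideanSpace ℝ (Fin 3))
          (p : ℝ → EuclideanSpace ℝ (Fin 3) → ℝ),
          FluidPDE.IsClassicalNSSolutionOn (Ico 0 T) μ 0 u p → u 0 = u₀ →
          (∀ t ∈ Ico 0 T, IsLatticePeriodic (u t) ∧ IsLatticePeriodic (p t)) →
            ∃ D : ℝ, ∀ t ∈ Ico 0 T, ∀ x : EuclideanSpace ℝ (Fin 3), ‖fderiv ℝ (u t) x‖ ≤ D := by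
  constructor
  · intro hreg u₀ hu₀ hdiv hper T u p hcl hu0 hperT
    exact (exists_bounds_of_clayPeriodic_solvable hμ.le hcl hu0 hperT (hreg u₀ hu₀ hdiv hper)).2
  · intro hbd u₀ hu₀ hdiv hper
    rcases clayPeriodic_solvable_or_gradientSupBlowup hμ hu₀ hdiv hper with
      hsol | ⟨T, -, u, p, hcl, hu0, hperT, hb, -, -⟩
    · exact hsol
    · obtain ⟨D, hD⟩ := hbd u₀ hu₀ hdiv hper T u p hcl hu0 hperT
      obtain ⟨t, ht, x, hMx⟩ := hb D
      exact absurd hMx (not_lt.2 (hD t ht x))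

/-- **(B) ⇔ the a priori gradient bound at every viscosity**; `clayPeriodic.Regularity` is the leaf
`NavierStokesExistenceSmoothPeriodic` (`clayPeriodic_regularity_iff`).
[cite: FeffermanClay2006, (B) with (8) (10) (11) p. 2] [cite: RobinsonRodrigoSadowskiCUP2016, §6.3, §8.1] -/
theorem clayPeriodic_regularity_iff_aprioriGradientBound :
    clayPeriodic.Regularity ↔
      ∀ μ : ℝ, 0 < μ →
      ∀ (u₀ : EuclideanSpace ℝ (Fin 3) → EuclideanSpace ℝ (Fin 3)), ContDiff ℝ ∞ u₀ →
        NSWave0.IsDivFree u₀ → IsLatticePeriodic u₀ →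
        ∀ (T : ℝ) (u : ℝ → EuclideanSpace ℝ (Fin 3) → EuclideanSpace ℝ (Fin 3))
          (p : ℝ → EuclideanSpace ℝ (Fin 3) → ℝ),
          FluidPDE.IsClassicalNSSolutionOn (Ico 0 T) μ 0 u p → u 0 = u₀ →
          (∀ t ∈ Ico 0 T, IsLatticePeriodic (u t) ∧ IsLatticePeriodic (p t)) →
            ∃ D : ℝ, ∀ t ∈ Ico 0 T, ∀ x : EuclideanSpace ℝ (Fin 3), ‖fderiv ℝ (u t) x‖ ≤ D :=
  ⟨fun h μ hμ => (clayPeriodic_regularityAt_iff_aprioriGradientBound hμ).1 (h μ hμ),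
    fun h μ hμ => (clayPeriodic_regularityAt_iff_aprioriGradientBound hμ).2 (h μ hμ)⟩

/-- **(B) ⇔ the a priori gradient bound at ONE viscosity `μ > 0`** (Δ7 scaling
`clayPeriodic_regularityAt_iff`). [cite: FeffermanClay2006, (B) p. 2] [cite: Tao2013Localisation, Rem. 1.2 footnote] -/
theorem clayPeriodic_regularity_iff_aprioriGradientBound_at {μ : ℝ} (hμ : 0 < μ) :
    clayPeriodic.Regularity ↔
      ∀ (u₀ : EuclideanSpace ℝ (Fin 3) → EuclideanSpace ℝ (Fin 3)), ContDiff ℝ ∞ u₀ →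
        NSWave0.IsDivFree u₀ → IsLatticePeriodic u₀ →
        ∀ (T : ℝ) (u : ℝ → EuclideanSpace ℝ (Fin 3) → EuclideanSpace ℝ (Fin 3))
          (p : ℝ → EuclideanSpace ℝ (Fin 3) → ℝ),
          FluidPDE.IsClassicalNSSolutionOn (Ico 0 T) μ 0 u p → u 0 = u₀ →
          (∀ t ∈ Ico 0 T, IsLatticePeriodic (u t) ∧ IsLatticePeriodic (p t)) →
            ∃ D : ℝ, ∀ t ∈ Ico 0 T, ∀ x : EuclideanSpace ℝ (Fin 3), ‖fderiv ℝ (u t) x‖ ≤ D := by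
  rw [← ClaySpec.regularityAt_iff_regularity hμ clayPeriodic_data_smul
    clayPeriodic_admissible_timeRescale]
  exact clayPeriodic_regularityAt_iff_aprioriGradientBound hμ

/-- **If (B) fails, it fails through a finite-time gradient blow-up of a periodic classical solution**
(some `μ > 0`, some smooth divergence-free periodic datum).
[cite: FeffermanClay2006, (B) (D) p. 2] [cite: RobinsonRodrigoSadowskiCUP2016, §6.3, §8.1] -/
theorem exists_gradientSupBlowup_of_not_clayPeriodic_regularity (h : ¬ clayPeriodic.Regularity) :
    ∃ μ : ℝ, 0 < μ ∧ ∃ u₀ : EuclideanSpace ℝ (Fin 3) → EuclideanSpace ℝ (Fin 3),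
      ContDiff ℝ ∞ u₀ ∧ NSWave0.IsDivFree u₀ ∧ IsLatticePeriodic u₀ ∧
      ∃ T : ℝ, 0 < T ∧
        ∃ (u : ℝ → EuclideanSpace ℝ (Fin 3) → EuclideanSpace ℝ (Fin 3))
          (p : ℝ → EuclideanSpace ℝ (Fin 3) → ℝ),
          FluidPDE.IsClassicalNSSolutionOn (Ico 0 T) μ 0 u p ∧ u 0 = u₀ ∧
          (∀ t ∈ Ico 0 T, IsLatticePeriodic (u t) ∧ IsLatticePeriodic (p t)) ∧
          ∀ M : ℝ, ∃ t ∈ Ico 0 T, ∃ x : EuclideanSpace ℝ (Fin 3), M < ‖fderiv ℝ (u t) x‖ := by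
  unfold ClaySpec.Regularity ClaySpec.RegularityAt at h
  push Not at h
  obtain ⟨μ, hμ, u₀, hu₀, hdiv, hper, hno⟩ := h
  exact ⟨μ, hμ, u₀, hu₀, hdiv, hper,
    (not_clayPeriodic_solvable_iff_exists_gradientSupBlowup hμ hu₀ hdiv hper).1 hno⟩

/-- **A finite-time gradient blow-up of one periodic classical solution, at one viscosity, proves
printed (D)** (the `∃`-packaged form of `navierStokesBreakdownPeriodic_of_gradientSupCertificate`).
[cite: FeffermanClay2006, (D) p. 2] [cite: Tao2013Localisation, Prop. 1.7, Rem. 1.2 footnote] -/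
theorem navierStokesBreakdownPeriodic_of_exists_gradientSupBlowup
    (h : ∃ μ : ℝ, 0 < μ ∧ ∃ u₀ : EuclideanSpace ℝ (Fin 3) → EuclideanSpace ℝ (Fin 3),
      ContDiff ℝ ∞ u₀ ∧ NSWave0.IsDivFree u₀ ∧ IsLatticePeriodic u₀ ∧
      ∃ T : ℝ, 0 < T ∧
        ∃ (u : ℝ → EuclideanSpace ℝ (Fin 3) → EuclideanSpace ℝ (Fin 3))
          (p : ℝ → EuclideanSpace ℝ (Fin 3) → ℝ),
          FluidPDE.IsClassicalNSSolutionOn (Ico 0 T) μ 0 u p ∧ u 0 = u₀ ∧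
          (∀ t ∈ Ico 0 T, IsLatticePeriodic (u t) ∧ IsLatticePeriodic (p t)) ∧
          ∀ M : ℝ, ∃ t ∈ Ico 0 T, ∃ x : EuclideanSpace ℝ (Fin 3), M < ‖fderiv ℝ (u t) x‖) :
    Summit.NavierStokesRegularity.NavierStokesRegularity.NavierStokesBreakdownPeriodic := by
  obtain ⟨μ, hμ, u₀, hu₀, hdiv, hper, T, -, u, p, hcl, hu0, hperT, hb⟩ := h
  exact navierStokesBreakdownPeriodic_of_gradientSupCertificate hμ hu₀ hdiv hper hcl hu0 hperT hb

/-- **(B) fails ⇒ printed (D) holds, through an explicit blow-up** (the periodic dichotomy in blow-up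
form; the bare `(B) ∨ (D)`-type statement is `clayPeriodic_breakdownAt_of_not_regularityAt` of
`ClayVariants.lean`). [cite: FeffermanClay2006, (B) (D) p. 2] -/
theorem navierStokesBreakdownPeriodic_of_not_clayPeriodic_regularity (h : ¬ clayPeriodic.Regularity) :
    Summit.NavierStokesRegularity.NavierStokesRegularity.NavierStokesBreakdownPeriodic :=
  navierStokesBreakdownPeriodic_of_exists_gradientSupBlowup
    (exists_gradientSupBlowup_of_not_clayPeriodic_regularity h)

/-! ## (B) ⇔ the a priori ENSTROPHY bound (rev 2, lit-4 g5) -/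

/-- **Printed-(10) solvability bounds the enstrophy per period cell**: if `(ν, 0, u₀)` is solvable in
the printed class (10) (`ν ≥ 0`), then along every classical solution `(u, p)` on `[0, T) × ℝ³` from
`u₀` with `u(·,t)`, `p(·,t)` periodic, the enstrophy of the descended torus slices
`Torus.gradNormSq (u t ∘ repr) = ∫_{𝕋³} Σᵢ ‖∂ᵢu(t)‖²` is bounded above on `[0, T)` (a gradient bound
`D` from `exists_bounds_of_clayPeriodic_solvable` bounds it by `3D²`).
[cite: FeffermanClay2006, (B) with (8) (10) (11) p. 2] [cite: MajdaBertozzi2002, Cor. 3.1 (uniqueness on 𝕋³)] -/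
theorem bddAbove_enstrophy_of_clayPeriodic_solvable (hν : 0 ≤ ν) {T : ℝ}
    {u : ℝ → EuclideanSpace ℝ (Fin 3) → EuclideanSpace ℝ (Fin 3)} {p : ℝ → EuclideanSpace ℝ (Fin 3) → ℝ}
    (hcl : FluidPDE.IsClassicalNSSolutionOn (Ico 0 T) ν 0 u p) (hu0 : u 0 = u₀)
    (hperT : ∀ t ∈ Ico 0 T, IsLatticePeriodic (u t) ∧ IsLatticePeriodic (p t))
    (hsol : clayPeriodic.Solvable ν 0 u₀) :
    BddAbove ((fun t => Torus.gradNormSq (fun x => u t (Torus.repr x))) '' Ico 0 T) := by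
  obtain ⟨-, D, hD⟩ := exists_bounds_of_clayPeriodic_solvable hν hcl hu0 hperT hsol
  obtain ⟨hU, hlift⟩ := torus_descend_of_periodic hcl hperT
  refine ⟨3 * D ^ 2, ?_⟩
  rintro _ ⟨t, ht, rfl⟩
  refine torus_gradNormSq_le_of_norm_fderiv_lift_le (hU.smooth_velocity.isSmooth_slice ht) fun y => ?_
  rw [hlift t ht]
  exact hD t ht y

/-- **An ENSTROPHY blow-up certificate excludes printed-(10) solvability**: a classical solution on
`[0, T) × ℝ³` from `u₀` with `u(·,t)`, `p(·,t)` periodic whose enstrophy per period cell is NOT bounded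
above on `[0, T)` ⇒ `(ν, 0, u₀)` is not solvable in the class (10).
[cite: FeffermanClay2006, (B) (D) with (8) (10) (11) p. 2] [cite: MajdaBertozzi2002, Cor. 3.1] -/
theorem not_clayPeriodic_solvable_of_enstrophyBlowupCertificate (hν : 0 ≤ ν) {T : ℝ}
    {u : ℝ → EuclideanSpace ℝ (Fin 3) → EuclideanSpace ℝ (Fin 3)} {p : ℝ → EuclideanSpace ℝ (Fin 3) → ℝ}
    (hcl : FluidPDE.IsClassicalNSSolutionOn (Ico 0 T) ν 0 u p) (hu0 : u 0 = u₀)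
    (hperT : ∀ t ∈ Ico 0 T, IsLatticePeriodic (u t) ∧ IsLatticePeriodic (p t))
    (hblow : ¬ BddAbove ((fun t => Torus.gradNormSq (fun x => u t (Torus.repr x))) '' Ico 0 T)) :
    ¬ clayPeriodic.Solvable ν 0 u₀ := fun hsol =>
  hblow (bddAbove_enstrophy_of_clayPeriodic_solvable hν hcl hu0 hperT hsol)

/-- **One periodic enstrophy blow-up certificate at one viscosity `ν > 0` proves Clay (D) as printed.**
[cite: FeffermanClay2006, (D) p. 2] [cite: Tao2013Localisation, Prop. 1.7, Rem. 1.2 footnote] -/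
theorem navierStokesBreakdownPeriodic_of_enstrophyBlowupCertificate (hν : 0 < ν) {T : ℝ}
    {u : ℝ → EuclideanSpace ℝ (Fin 3) → EuclideanSpace ℝ (Fin 3)} {p : ℝ → EuclideanSpace ℝ (Fin 3) → ℝ}
    (hu₀ : ContDiff ℝ ∞ u₀) (hdiv : NSWave0.IsDivFree u₀) (hper : IsLatticePeriodic u₀)
    (hcl : FluidPDE.IsClassicalNSSolutionOn (Ico 0 T) ν 0 u p) (hu0 : u 0 = u₀)
    (hperT : ∀ t ∈ Ico 0 T, IsLatticePeriodic (u t) ∧ IsLatticePeriodic (p t))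
    (hblow : ¬ BddAbove ((fun t => Torus.gradNormSq (fun x => u t (Torus.repr x))) '' Ico 0 T)) :
    Summit.NavierStokesRegularity.NavierStokesRegularity.NavierStokesBreakdownPeriodic :=
  navierStokesBreakdownPeriodic_of_not_errataSolvable_zero hν hu₀ hdiv hper fun h =>
    not_clayPeriodic_solvable_of_enstrophyBlowupCertificate hν.le hcl hu0 hperT hblow
      ((clayPeriodic_solvable_zero_iff_errata ν u₀).2 h)

/-- **Printed-(10) solvability of one periodic Cauchy problem fails iff its classical solution blows up
in ENSTROPHY in finite time** (`ν > 0`, `u₀` smooth divergence free `ℤ³`-periodic):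
`¬ clayPeriodic.Solvable ν 0 u₀ ↔ ∃ T > 0, ∃ (u, p)` classical on `[0, T) × ℝ³`, `u 0 = u₀`, `u(·,t)`,
`p(·,t)` periodic, with the enstrophy per period cell not bounded above on `[0, T)` ((⇒) the enstrophy
clause of `clayPeriodic_solvable_or_gradientSupBlowup`, i.e. the tree's maximal torus solution with
Robinson–Rodrigo–Sadowski's Lemma 6.11; (⇐) `not_clayPeriodic_solvable_of_enstrophyBlowupCertificate`).
[cite: FeffermanClay2006, (B) (D) with (8) (10) (11) p. 2] [cite: RobinsonRodrigoSadowskiCUP2016, Lemma 6.11 with Thm 6.8, §8.1] -/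
theorem not_clayPeriodic_solvable_iff_exists_enstrophyBlowup (hν : 0 < ν) (hu₀ : ContDiff ℝ ∞ u₀)
    (hdiv : NSWave0.IsDivFree u₀) (hper : IsLatticePeriodic u₀) :
    ¬ clayPeriodic.Solvable ν 0 u₀ ↔
      ∃ T : ℝ, 0 < T ∧
        ∃ (u : ℝ → EuclideanSpace ℝ (Fin 3) → EuclideanSpace ℝ (Fin 3))
          (p : ℝ → EuclideanSpace ℝ (Fin 3) → ℝ),
          FluidPDE.IsClassicalNSSolutionOn (Ico 0 T) ν 0 u p ∧ u 0 = u₀ ∧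
          (∀ t ∈ Ico 0 T, IsLatticePeriodic (u t) ∧ IsLatticePeriodic (p t)) ∧
          ¬ BddAbove ((fun t => Torus.gradNormSq (fun x => u t (Torus.repr x))) '' Ico 0 T) := by
  constructor
  · intro hno
    rcases clayPeriodic_solvable_or_gradientSupBlowup hν hu₀ hdiv hper with
      hsol | ⟨T, hT, u, p, hcl, hu0, hperT, -, hnb, -⟩
    · exact absurd hsol hno
    · exact ⟨T, hT, u, p, hcl, hu0, hperT, hnb⟩
  · rintro ⟨T, -, u, p, hcl, hu0, hperT, hnb⟩
    exact not_clayPeriodic_solvable_of_enstrophyBlowupCertificate hν.le hcl hu0 hperT hnb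

/-- **(B) at one viscosity ⇔ the a priori ENSTROPHY bound** (`μ > 0`): `clayPeriodic.RegularityAt μ` ⇔
every classical solution of the unforced system on a half-open slab `[0, T) × ℝ³` from a smooth
divergence-free `ℤ³`-periodic datum, with `u(·,t)` and `p(·,t)` periodic, has its enstrophy per period
cell `∫_{𝕋³} Σᵢ ‖∂ᵢu(t)‖²` (`Torus.gradNormSq` of the descended slices) BOUNDED ABOVE on `[0, T)`
((⇒) `bddAbove_enstrophy_of_clayPeriodic_solvable`; (⇐) the enstrophy clause of
`clayPeriodic_solvable_or_gradientSupBlowup`).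
[cite: FeffermanClay2006, (B) with (8) (10) (11) p. 2] [cite: RobinsonRodrigoSadowskiCUP2016, Lemma 6.11 with Thm 6.8, §8.1] -/
theorem clayPeriodic_regularityAt_iff_aprioriEnstrophyBound {μ : ℝ} (hμ : 0 < μ) :
    clayPeriodic.RegularityAt μ ↔
      ∀ (u₀ : EuclideanSpace ℝ (Fin 3) → EuclideanSpace ℝ (Fin 3)), ContDiff ℝ ∞ u₀ →
        NSWave0.IsDivFree u₀ → IsLatticePeriodic u₀ →
        ∀ (T : ℝ) (u : ℝ → EuclideanSpace ℝ (Fin 3) → EuclideanSpace ℝ (Fin 3))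
          (p : ℝ → EuclideanSpace ℝ (Fin 3) → ℝ),
          FluidPDE.IsClassicalNSSolutionOn (Ico 0 T) μ 0 u p → u 0 = u₀ →
          (∀ t ∈ Ico 0 T, IsLatticePeriodic (u t) ∧ IsLatticePeriodic (p t)) →
            BddAbove ((fun t => Torus.gradNormSq (fun x => u t (Torus.repr x))) '' Ico 0 T) := by
  constructor
  · intro hreg u₀ hu₀ hdiv hper T u p hcl hu0 hperT
    exact bddAbove_enstrophy_of_clayPeriodic_solvable hμ.le hcl hu0 hperT (hreg u₀ hu₀ hdiv hper)
  · intro hbd u₀ hu₀ hdiv hper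
    rcases clayPeriodic_solvable_or_gradientSupBlowup hμ hu₀ hdiv hper with
      hsol | ⟨Ts, -, u, p, hcl, hu0, hperT, -, hnb, -⟩
    · exact hsol
    · exact absurd (hbd u₀ hu₀ hdiv hper Ts u p hcl hu0 hperT) hnb

/-- **(B) ⇔ the a priori enstrophy bound at every viscosity.**
[cite: FeffermanClay2006, (B) with (8) (10) (11) p. 2] [cite: RobinsonRodrigoSadowskiCUP2016, Lemma 6.11 with Thm 6.8, §8.1] -/
theorem clayPeriodic_regularity_iff_aprioriEnstrophyBound :
    clayPeriodic.Regularity ↔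
      ∀ μ : ℝ, 0 < μ →
      ∀ (u₀ : EuclideanSpace ℝ (Fin 3) → EuclideanSpace ℝ (Fin 3)), ContDiff ℝ ∞ u₀ →
        NSWave0.IsDivFree u₀ → IsLatticePeriodic u₀ →
        ∀ (T : ℝ) (u : ℝ → EuclideanSpace ℝ (Fin 3) → EuclideanSpace ℝ (Fin 3))
          (p : ℝ → EuclideanSpace ℝ (Fin 3) → ℝ),
          FluidPDE.IsClassicalNSSolutionOn (Ico 0 T) μ 0 u p → u 0 = u₀ →
          (∀ t ∈ Ico 0 T, IsLatticePeriodic (u t) ∧ IsLatticePeriodic (p t)) →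
            BddAbove ((fun t => Torus.gradNormSq (fun x => u t (Torus.repr x))) '' Ico 0 T) :=
  ⟨fun h μ hμ => (clayPeriodic_regularityAt_iff_aprioriEnstrophyBound hμ).1 (h μ hμ),
    fun h μ hμ => (clayPeriodic_regularityAt_iff_aprioriEnstrophyBound hμ).2 (h μ hμ)⟩

/-- **(B) ⇔ the a priori enstrophy bound at ONE viscosity `μ > 0`.**
[cite: FeffermanClay2006, (B) p. 2] [cite: Tao2013Localisation, Rem. 1.2 footnote] -/
theorem clayPeriodic_regularity_iff_aprioriEnstrophyBound_at {μ : ℝ} (hμ : 0 < μ) :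
    clayPeriodic.Regularity ↔
      ∀ (u₀ : EuclideanSpace ℝ (Fin 3) → EuclideanSpace ℝ (Fin 3)), ContDiff ℝ ∞ u₀ →
        NSWave0.IsDivFree u₀ → IsLatticePeriodic u₀ →
        ∀ (T : ℝ) (u : ℝ → EuclideanSpace ℝ (Fin 3) → EuclideanSpace ℝ (Fin 3))
          (p : ℝ → EuclideanSpace ℝ (Fin 3) → ℝ),
          FluidPDE.IsClassicalNSSolutionOn (Ico 0 T) μ 0 u p → u 0 = u₀ →
          (∀ t ∈ Ico 0 T, IsLatticePeriodic (u t) ∧ IsLatticePeriodic (p t)) →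
            BddAbove ((fun t => Torus.gradNormSq (fun x => u t (Torus.repr x))) '' Ico 0 T) := by
  rw [← ClaySpec.regularityAt_iff_regularity hμ clayPeriodic_data_smul
    clayPeriodic_admissible_timeRescale]
  exact clayPeriodic_regularityAt_iff_aprioriEnstrophyBound hμ

/-- **If (B) fails, it fails through an enstrophy blow-up of a periodic classical solution.**
[cite: FeffermanClay2006, (B) (D) p. 2] [cite: RobinsonRodrigoSadowskiCUP2016, Lemma 6.11, §8.1] -/
theorem exists_enstrophyBlowup_of_not_clayPeriodic_regularity (h : ¬ clayPeriodic.Regularity) :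
    ∃ μ : ℝ, 0 < μ ∧ ∃ u₀ : EuclideanSpace ℝ (Fin 3) → EuclideanSpace ℝ (Fin 3),
      ContDiff ℝ ∞ u₀ ∧ NSWave0.IsDivFree u₀ ∧ IsLatticePeriodic u₀ ∧
      ∃ (T : ℝ) (u : ℝ → EuclideanSpace ℝ (Fin 3) → EuclideanSpace ℝ (Fin 3))
        (p : ℝ → EuclideanSpace ℝ (Fin 3) → ℝ),
        FluidPDE.IsClassicalNSSolutionOn (Ico 0 T) μ 0 u p ∧ u 0 = u₀ ∧
        (∀ t ∈ Ico 0 T, IsLatticePeriodic (u t) ∧ IsLatticePeriodic (p t)) ∧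
        ¬ BddAbove ((fun t => Torus.gradNormSq (fun x => u t (Torus.repr x))) '' Ico 0 T) := by
  rw [clayPeriodic_regularity_iff_aprioriEnstrophyBound] at h
  push Not at h
  exact h

end

end Literature.Claims.NS.ClayVariants

-- WHAT THIS IS NOT: not a claim about NS regularity or blow-up; not a claim about any author beyond
-- the typed locator.
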